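import Mathlib
import HarnessLib
import Summits.HubbardSuperconductivity.HubbardSuperconductivity.Theorems.KLProgrammeKLRegimeSplitThermalLayer

/-!
# Route `KLProgramme` — ENGINE (stmt-HubbardSuperconductivity-20437 `KLRegimeEngineV17F2`), row (c) binders #8/#9 (cures of located #22/#23): the LADDER-UNIFORM
# frequency-count constant — on the whole thermal ladder `n ≤ n_β + 1` the `+1` of the Matsubara count `r₂β/π + 1` is at most `16·r₂β/π`
# (cell gate-hubbard-kl, seat hubbard-kl-k3c2-p2 g31, technique «thermal-bar induction n ≤ nScales β + 1 with EngineBoundsAtV4S sums»)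

WHY.  The bricks O5a/O6a/O6b carry the frequency count `N = r₂β/π + 1` (`klok_card_freq_le`) and `+1/β`, `+3/β` addenda; the by-value memos
(`g31/LOCALISED-ROW-BY-VALUE.md`, `g31/PH-ROTATION-BY-VALUE.md`) replace them by `≤ 17·r₂β/π` / `≤ 16r₂/π` on the ladder.  This file is that arithmetic as a theorem:
`π/β ≤ Λ_{n_β}` (`klth_pi_div_le_klScale_nScales`) and `n ≤ n_β + 1 ⇒ Λ_{n_β} ≤ 16·Λₙ₊₁`, so for every `r₂ ≥ Λₙ₊₁`:
* `klok_klScale_nScales_le_sixteen_mul` — `Λ_{n_β} ≤ 16·Λₙ₊₁` for `n ≤ n_β + 1`;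
* **`klok_inv_beta_le_ladder`** — `1/β ≤ 16·r₂/π`;  **`klok_card_freq_le_ladder`** — `r₂β/π + 1 ≤ 17·(r₂β/π)`.
Pure arithmetic on the tree's scale ladder; no definitions; nothing asserts (c), K3 or superconductivity.
-/

noncomputable section

namespace Summit.HubbardSuperconductivity.HubbardSuperconductivity.Theorems.KLRegimeSplit

set_option linter.dupNamespace false -- summit = problem name (single-conjunct summit), D-0017

open Real Summit.HubbardSuperconductivity.HubbardSuperconductivity.Theorems.KLProgrammeLegKernels

/-- `Λ_{n_β} ≤ 16·Λₙ₊₁` for `n ≤ n_β + 1` (`Λ_m = e₀·4^{−m}`). -/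
theorem klok_klScale_nScales_le_sixteen_mul {β : ℝ} {n : ℕ} (hn : n ≤ nScales β + 1) :
    klScale klE0 (nScales β) ≤ 16 * klScale klE0 (n + 1) := by
  have h1 : klScale klE0 (nScales β + 2) = klScale klE0 (nScales β) / 16 := by
    rw [klth_klScale_succ, klth_klScale_succ]; ring
  have h2 : klScale klE0 (nScales β + 2) ≤ klScale klE0 (n + 1) := by
    unfold klScale
    exact mul_le_mul_of_nonneg_left (inv_anti₀ (by positivity) (pow_le_pow_right₀ (by norm_num) (by omega))) (by unfold klE0; norm_num)
  rw [h1] at h2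
  linarith

/-- **`1/β ≤ 16·r₂/π` on the ladder**: `klBetaMin ≤ β`, `n ≤ n_β + 1`, `Λₙ₊₁ ≤ r₂`. -/
theorem klok_inv_beta_le_ladder {β : ℝ} (hβ : klBetaMin ≤ β) {n : ℕ} (hn : n ≤ nScales β + 1) {r₂ : ℝ} (hr₂ : klScale klE0 (n + 1) ≤ r₂) :
    1 / β ≤ 16 * r₂ / π := by
  have hβ0 : 0 < β := pos_of_klBetaMin_le hβ
  have hπ := Real.pi_pos
  have h := (klth_pi_div_le_klScale_nScales hβ).trans ((klok_klScale_nScales_le_sixteen_mul hn).trans (by linarith : 16 * klScale klE0 (n + 1) ≤ 16 * r₂))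
  rw [div_le_iff₀ hβ0] at h
  rw [div_le_div_iff₀ hβ0 hπ]
  linarith

/-- **The ladder-uniform frequency count**: `r₂β/π + 1 ≤ 17·(r₂β/π)` (`klBetaMin ≤ β`, `n ≤ n_β + 1`, `Λₙ₊₁ ≤ r₂`). -/
theorem klok_card_freq_le_ladder {β : ℝ} (hβ : klBetaMin ≤ β) {n : ℕ} (hn : n ≤ nScales β + 1) {r₂ : ℝ} (hr₂ : klScale klE0 (n + 1) ≤ r₂) :
    r₂ * β / π + 1 ≤ 17 * (r₂ * β / π) := by
  have hβ0 : 0 < β := pos_of_klBetaMin_le hβ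
  have hπ := Real.pi_pos
  have h := klok_inv_beta_le_ladder hβ hn hr₂
  rw [div_le_div_iff₀ hβ0 hπ, one_mul] at h
  have h16 : 1 ≤ 16 * (r₂ * β / π) := by
    rw [show 16 * (r₂ * β / π) = 16 * r₂ * β / π by ring, le_div_iff₀ hπ]
    linarith
  linarith

end Summit.HubbardSuperconductivity.HubbardSuperconductivity.Theorems.KLRegimeSplit

end
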